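import Literature.AlgebraicGeometry.Motives.GrothendieckExistenceWittTower
import Literature.AlgebraicGeometry.Motives.GrothendieckExistenceWitt
import Literature.AlgebraicGeometry.Modules.PushforwardClosedImmersionCoh
import Literature.AlgebraicGeometry.Morphisms.CohOfVectorBundle
import Literature.AlgebraicGeometry.Morphisms.FormalModuleCompletion
import HarnessLib

/-!
# Grothendieck's existence theorem for vector bundles over `W(k)`: reduction to the quotient model

`Literature.AlgebraicGeometry.Motives.GrothendieckExistence_vectorBundle_witt`
(`Motives/GrothendieckExistenceWitt.lean`; Görtz–Wedhorn II Thm. 24.94 with Prop. 24.95 for `𝒳`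
proper over `W(k)`) is stated in the RESTRICTION model: vector bundles `E_n` on the thickenings
`X_{n+1} = 𝒳 ⊗ W/pⁿ⁺¹` with `E_{n+1}|_{X_{n+1}} ≅ E_n` come, at level `1`, from a vector bundle `F` on `𝒳`.
Görtz–Wedhorn's proof of Thm. 24.94 (pp. 566–572: Artin–Rees and the theorem on formal functions,
§(24.18)–(24.20); the projective case via uniform Serre vanishing, Prop. 24.102 and Lemma 24.103; the
proper case via Chow's lemma and noetherian induction, 24.104–24.106) works throughout with COHERENT
modules and the QUOTIENT description `ℱ_{/Z} = (ℱ/𝒥ⁿ⁺¹ℱ)_n` ((24.18.1)) on `X` itself.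

This file proves, from the dictionary `Motives/GrothendieckExistenceWittTower.lean`, that the fact
FOLLOWS from the essential-surjectivity statement of Thm. 24.94 in the quotient model, spelled out
inline (no new named fact is introduced): **if every tower `(M_n)_n` of coherent `𝒪_𝒳`-modules with
`pⁿ⁺¹M_n = 0` and `M_{n+1}/pⁿ⁺¹M_{n+1} ≅ M_n` on a proper `𝒳/W(k)` is levelwise `F/pⁿ⁺¹F` for a finitely
presented `F`, then `GrothendieckExistence_vectorBundle_witt` holds**
(`GrothendieckExistence_vectorBundle_witt.of_cokernelAlgebraization`): the direct images
`M_n = ι_{n+1*}E_n` of the given formal vector bundle are coherent (`Morphisms/CohOfVectorBundle`,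
`Modules/PushforwardClosedImmersionCoh`), killed by `pⁿ⁺¹` and linked by the quotient transition
isomorphisms (`WittScheme.pushforwardTransitionIso`); an `F` with `F/pⁿ⁺¹F ≅ M_n` is then a vector bundle
with `ι_1^*F ≅ E_0` (`WittScheme.isVectorBundle_and_iso_of_cokernelIsos`: `ι_n^*F ≅ E_n` for free by
adjunction, and the algebraic half of Prop. 24.95, `FormalGeometry/LocallyFreeOfThickenings`).

What the hypothesis still asks for is exactly Görtz–Wedhorn II Thm. 24.94 (essential surjectivity, for
the towers arising from formal vector bundles) in the language of `Morphisms/FormalFunctionsModule*`;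
compatibility of the isomorphisms `F/pⁿ⁺¹F ≅ M_n` with the transitions is NOT needed downstream. The
same reduction is also given in the tower language of `Morphisms/FormalModuleTower` /
`Morphisms/FormalModuleCompletion` (`GrothendieckExistence_vectorBundle_witt.of_towerAlgebraization`):
it suffices that every formal tower of coherent modules along `p` on a proper `𝒳/W(k)` has its levels
isomorphic to those of the completion `cmplTower p F` of a finitely presented `F`.

## References

* U. Görtz, T. Wedhorn, *Algebraic Geometry II: Cohomology of Schemes*, Springer Spektrum (2023),
  doi:10.1007/978-3-658-43031-3: Thm. 24.94, Prop. 24.95 (p. 566), (24.18.1) (p. 562), 24.102–24.106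
  (pp. 569–572). [GortzWedhorn2023]
* A. Grothendieck, EGA III₁ (1961), Thm. 5.1.4. [EGAIII1]
-/

noncomputable section

open CategoryTheory AlgebraicGeometry Limits

universe u

namespace Literature.AlgebraicGeometry.Motives

open WittScheme Literature.AlgebraicGeometry.Modules Literature.AlgebraicGeometry.Morphisms

/-- **The direct-image tower of a formal vector bundle is a coherent tower in the quotient model.**
For vector bundles `E_n` on the thickenings `X_{n+1}` of a `W(k)`-scheme with
`E_{n+1}|_{X_{n+1}} ≅ E_n`, the `𝒪_𝒳`-modules `M_n = ι_{n+1*}E_n` are coherent (`Coh`), killed by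
`pⁿ⁺¹`, and `M_{n+1}/pⁿ⁺¹M_{n+1} ≅ M_n`. [cite: GortzWedhorn2023, Def. 24.85 and (24.18.1) (pp. 561–562)] -/
theorem coh_tower_of_formalVectorBundle {p : ℕ} [Fact p.Prime] {k : Type u} [CommRing k]
    (𝒳 : SchemeOver (WittVector p k)) (E : ∀ n : ℕ, (thickening 𝒳 (n + 1)).left.Modules)
    (hE : ∀ n, IsVectorBundle (E n))
    (hcompat : ∀ n, Nonempty ((Scheme.Modules.pullback
      (thickeningMap 𝒳 (Nat.le_succ (n + 1)))).obj (E (n + 1)) ≅ E n)) :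
    (∀ n, Coh ((Scheme.Modules.pushforward (thickeningι 𝒳 (n + 1))).obj (E n))) ∧
    (∀ n, globalScalar ((Scheme.Modules.pushforward (thickeningι 𝒳 (n + 1))).obj (E n))
      (algebraMapΓ 𝒳.hom ((p : WittVector p k) ^ (n + 1))) = 0) ∧
    (∀ n, Nonempty (cokernel (globalScalar
        ((Scheme.Modules.pushforward (thickeningι 𝒳 (n + 2))).obj (E (n + 1)))
        (algebraMapΓ 𝒳.hom ((p : WittVector p k) ^ (n + 1)))) ≅
      (Scheme.Modules.pushforward (thickeningι 𝒳 (n + 1))).obj (E n))) :=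
  ⟨fun n => coh_pushforward_of_isClosedImmersion _ (coh_of_isVectorBundle (hE n)),
    fun n => globalScalar_pushforward_eq_zero _ (appTop_thickeningι_algebraMapΓ_pow 𝒳 (n + 1)) (E n),
    fun n => ⟨pushforwardTransitionIso E hE (fun m => (hcompat m).some) n⟩⟩

/-- **Reduction of Grothendieck's existence theorem for vector bundles over `W(k)` to the quotient
model.** If, for every proper `𝒳 → Spec W(k)` (`k` perfect of characteristic `p`), every tower
`(M_n)_n` of coherent `𝒪_𝒳`-modules with `pⁿ⁺¹M_n = 0` and isomorphisms `M_{n+1}/pⁿ⁺¹M_{n+1} ≅ M_n` is,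
levelwise, `F/pⁿ⁺¹F` for some finitely presented `𝒪_𝒳`-module `F` (Görtz–Wedhorn II Thm. 24.94,
essential surjectivity, in the description `ℱ_{/Z} = (ℱ/𝒥ⁿ⁺¹ℱ)_n` of (24.18.1)), then
`GrothendieckExistence_vectorBundle_witt` holds: apply the hypothesis to the direct-image tower
`M_n = ι_{n+1*}E_n` (`coh_tower_of_formalVectorBundle`) and read the levelwise isomorphisms back in
the restriction model (`WittScheme.isVectorBundle_and_iso_of_cokernelIsos`, Prop. 24.95).
[cite: GortzWedhorn2023, Thm 24.94 and Prop 24.95 (p. 566)] -/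
theorem GrothendieckExistence_vectorBundle_witt.of_cokernelAlgebraization
    (H : ∀ (p : ℕ) [Fact p.Prime] (k : Type u) [Field k] [CharP k p] [PerfectRing k p]
      (𝒳 : SchemeOver (WittVector p k)), IsProper 𝒳.hom →
      ∀ (M : ℕ → 𝒳.left.Modules), (∀ n, Coh (M n)) →
        (∀ n, globalScalar (M n) (algebraMapΓ 𝒳.hom ((p : WittVector p k) ^ (n + 1))) = 0) →
        (∀ n, Nonempty (cokernel (globalScalar (M (n + 1))
          (algebraMapΓ 𝒳.hom ((p : WittVector p k) ^ (n + 1)))) ≅ M n)) →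
        ∃ F : 𝒳.left.Modules, SheafOfModules.IsFinitePresentation.{u, u, u} F ∧
          ∀ n, Nonempty (cokernel (globalScalar F
            (algebraMapΓ 𝒳.hom ((p : WittVector p k) ^ (n + 1)))) ≅ M n)) :
    GrothendieckExistence_vectorBundle_witt.{u} := by
  intro p _ k _ _ _ 𝒳 h𝒳 E hE hcompat
  haveI := h𝒳
  obtain ⟨hcoh, hkill, htrans⟩ := coh_tower_of_formalVectorBundle 𝒳 E hE hcompat
  obtain ⟨F, hF, β⟩ := H p k 𝒳 h𝒳
    (fun n => (Scheme.Modules.pushforward (thickeningι 𝒳 (n + 1))).obj (E n)) hcoh hkill htrans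
  obtain ⟨hVB, e⟩ := isVectorBundle_and_iso_of_cokernelIsos 𝒳 E hE F hF fun n => (β n).some
  exact ⟨F, hVB, e⟩

/-- Powers of the global function `p`: `algebraMapΓ (pᵐ) = (algebraMapΓ p)ᵐ`. [folklore] -/
theorem algebraMapΓ_pow {p : ℕ} [Fact p.Prime] {k : Type u} [CommRing k]
    (𝒳 : SchemeOver (WittVector p k)) (m : ℕ) :
    algebraMapΓ 𝒳.hom ((p : WittVector p k) ^ m) = algebraMapΓ 𝒳.hom (p : WittVector p k) ^ m :=
  map_pow _ _ _

/-- **Reduction to the tower language.** If, for every proper `𝒳 → Spec W(k)`, every formal tower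
`F` of coherent `𝒪_𝒳`-modules along the global function `p` (`Morphisms/FormalModuleTower.IsFormalTower`)
has its levels isomorphic to the levels `G/pⁿ⁺¹G` of the completion (`Morphisms/FormalModuleCompletion.cmplTower`)
of some finitely presented `𝒪_𝒳`-module `G` (Görtz–Wedhorn II Thm. 24.94, essential surjectivity),
then `GrothendieckExistence_vectorBundle_witt` holds (via `of_cokernelAlgebraization` and the tower
`towerOfIsos` attached to the data `(M_n, M_{n+1}/pⁿ⁺¹ ≅ M_n)`).
[cite: GortzWedhorn2023, Thm 24.94 and Prop 24.95 (p. 566)] -/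
theorem GrothendieckExistence_vectorBundle_witt.of_towerAlgebraization
    (H : ∀ (p : ℕ) [Fact p.Prime] (k : Type u) [Field k] [CharP k p] [PerfectRing k p]
      (𝒳 : SchemeOver (WittVector p k)), IsProper 𝒳.hom →
      ∀ (F : ℕᵒᵖ ⥤ 𝒳.left.Modules), IsFormalTower (algebraMapΓ 𝒳.hom (p : WittVector p k)) F →
        (∀ n, Coh (F.obj ⟨n⟩)) →
        ∃ G : 𝒳.left.Modules, SheafOfModules.IsFinitePresentation.{u, u, u} G ∧
          ∀ n, Nonempty ((cmplTower (algebraMapΓ 𝒳.hom (p : WittVector p k)) G).obj ⟨n⟩ ≅ F.obj ⟨n⟩)) :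
    GrothendieckExistence_vectorBundle_witt.{u} := by
  refine GrothendieckExistence_vectorBundle_witt.of_cokernelAlgebraization fun p _ k _ _ _ 𝒳 h𝒳 M hM hk hβ => ?_
  -- the tower attached to `(M_n, β_n)`, along `a = p`
  set a : Γ(𝒳.left, ⊤) := algebraMapΓ 𝒳.hom (p : WittVector p k) with ha
  have hpow : ∀ m, algebraMapΓ 𝒳.hom ((p : WittVector p k) ^ m) = a ^ m := algebraMapΓ_pow 𝒳
  let β : ∀ n, cokernel (globalScalar (M (n + 1)) (a ^ (n + 1))) ≅ M n := fun n =>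
    cokernelIsoOfEq (by rw [hpow]) ≪≫ (hβ n).some
  have hk' : ∀ n, globalScalar (M n) (a ^ (n + 1)) = 0 := fun n => by rw [← hpow]; exact hk n
  obtain ⟨G, hG, e⟩ := H p k 𝒳 h𝒳 (towerOfIsos a M β) (IsFormalTower.ofIsos a M β hk') hM
  refine ⟨G, hG, fun n => ⟨cokernelIsoOfEq (by rw [hpow]) ≪≫ (e n).some⟩⟩

end Literature.AlgebraicGeometry.Motives

end
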